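import Mathlib.NumberTheory.Real.Irrational
import Literature.AlgebraicGeometry.Frobenioids.MotivatingExamplesSub
import Literature.AlgebraicGeometry.Frobenioids.MotivatingExamplesSubGeomHypothesesFSM
import Literature.Barriers.ResolutionOfSingularities.InseparableBaseChange
import HarnessLib

/-!
# Frobenioids I, §6 sub-DAG, rows T62ii/L04 `Thm62_geomIsFrobenioid` and T62ii/L06 `Thm62ii_unconditional`:
# EXACT dependence on the base category, and the universal closures AS TYPED (no `K̃/K` Galois) REFUTED

Mochizuki, *The geometry of Frobenioids I: the general theory*, Kyushu J. Math. **62** (2008) 293–400,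
Example 6.1 p. 109 ("`K̃` a Galois extension of `K` … by Theorem 5.2, (ii), this data determines a [model]
Frobenioid"), Def. 1.1 (ii) p. 19 / (iv) p. 21 (a pre-Frobenioid `C → F_Φ` has `Φ` a MONOID ON `D`:
pull-backs along FSM-morphisms are bijective), Theorem 6.2 (ii) p. 110, proof of Thm. 6.2 (iii) p. 111 ("every
monomorphism of `D` is an isomorphism, hence `D` is of FSM-type") [cite: MochizukiFrdI2008, Ex. 6.1 p.109]
[cite: MochizukiFrdI2008, Thm. 6.2 (ii) p.110] [cite: MochizukiFrdI2008, Thm. 6.2 (iii) p.111].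

PROOF-ONLY companion (cell abc-iut, block F fact-proving wave, seat abc-iut-f-043; FACT-LIST rows F-1134
`Thm62_geomIsFrobenioid` and F-1135 `Thm62ii_unconditional` of `plan/FACT-LIST.md`, both
`kernel_closedness = parametrised`, R7-demoted to "proved at named instance families only"). No definitions,
nothing re-typed; the declaring file `MotivatingExamplesSub.lean` is imported, never edited.

WHAT THE KERNEL RECORDS. Both rows are typed over an ARBITRARY extension `Kt/K`
(`variable {K Kt} [Field K] [Field Kt] [Algebra K Kt] (Γ : GeometricDivisorData K Kt)`), the print's standing
hypothesis being "`K̃/K` Galois". Row T62ii/L04 says the model pre-Frobenioid `C_{K̃/K} → F_Φ` of the data of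
Ex. 6.1 IS a Frobenioid; row T62ii/L06 packages it with Thm. 6.2 (ii) (`∃ hF : IsFrobenioid …, Ψ ≅ naive`).
A Frobenioid is in particular a pre-Frobenioid (Def. 1.3 ⊇ Def. 1.1 (iv)), so `Φ = geomDivisorFunctor Γ` must be a
monoid on `D = FinSubextCat K Kt` (Def. 1.1 (ii)(b): FSM-morphisms pull back to bijections). Hence, EXACTLY as
for row T62ii/L03 (`forall_Thm62_geomHypotheses_iff_isOfFSMType`, abc-iut-f-043):
* `forall_Thm62_geomIsFrobenioid_iff_isOfFSMType`, `forall_Thm62ii_unconditional_iff_isOfFSMType` — each row holds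
  for EVERY interface datum `Γ` **iff `D` is of FSM-type**: "if" through abc-iut-f-043's
  `geom_hypotheses_of_isOfFSMType` and the trunk compositions `Thm62_geomIsFrobenioid_of_hypotheses`,
  `Thm62ii_unconditional_of` + abc-iut-L6-t10's `Thm62ii_holds`; "only if" through the admissible datum `Γ_σ` of an
  FSM-morphism `σ` that is not an isomorphism (`exists_not_isMonoidOn_geomDivisorFunctor_of_not_isOfFSMType`: one
  prime divisor everywhere, ramification `1`, `B = 1`, `Φ(N) = 2ℤ_{≥0}` when `[N : K] ≤ [M : K]` and `ℤ_{≥0}`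
  otherwise — `1 ∈ Φ(L)` is not pulled back from `Φ(M)`);
* the Galois case is the landed instance `FinSubextCat.isOfFSMType` (abc-iut-L6-t10), i.e. the rows' instance forms
  `Thm62_geomIsFrobenioid_holds`, `Thm62ii_unconditional_holds` (`GeometricFrobenioidStandard.lean`, cited not
  restated);
* the universal closures AS TYPED are FALSE: `FinSubextCat.not_isOfFSMType_rat_real` (`ℝ/ℚ`: the arrow
  `Spec ℚ(∛2) → Spec ℚ` is an FSM-morphism, not an isomorphism — rigidity of the real cube root) gives
  `not_forall_Thm62_geomIsFrobenioid`; in characteristic `p` (row T62ii/L06 carries `[CharP K p]`) the purely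
  inseparable `𝔽_p(t^{1/p})/𝔽_p(t)` (the tree's `Barriers.ResolutionOfSingularities.extField p / baseField p`:
  `Spec 𝔽_p(t^{1/p}) → Spec 𝔽_p(t)` is an FSM-morphism, not an isomorphism — `p`-th roots are unique) gives
  `FinSubextCat.not_isOfFSMType_inseparable` and `not_forall_Thm62ii_unconditional`.
Both FSM-type failures go through one rigidity lemma, `FinSubextCat.isFSM_of_rigid` /
`FinSubextCat.not_isOfFSMType_of_rigid`. So F-1134 / F-1135
are: universal closure REFUTED; instance form (Galois, as printed — more generally `D` of FSM-type) PROVED;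
consumers keep `[IsGalois K Kt]` or take `IsOfFSMType (FinSubextCat K Kt)`. Nothing here bears on [IUTchIII]
Cor. 3.12 or asserts anything about abc.
-/

namespace Literature.AlgebraicGeometry.Frobenioids

open CategoryTheory Opposite Function IntermediateField Polynomial

/-! ### The base category: FSM-type fails as soon as one rigid non-rational generator exists -/

section Rigid

variable {K : Type} [Field K] {Kt : Type} [Field Kt] [Algebra K Kt]

/-- An FSM-morphism `Spec L → Spec K` of `D = FinSubextCat K Kt` with `[L : K] > 1` witnesses that `D` is not
of FSM-type (an isomorphism would embed `L` into `K`). [cite: MochizukiFrdI2008, Thm. 6.2 (iii) p.111] -/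
theorem FinSubextCat.not_isOfFSMType_of_isFSM_to_bot (X : FinSubextCat K Kt)
    (hX : ¬ Module.finrank K X.L ≤ 1) (σ : X ⟶ (⟨⊥⟩ : FinSubextCat K Kt)) (hσ : IsFSM σ) :
    ¬ IsOfFSMType (FinSubextCat K Kt) := by
  intro hD
  haveI := hD.isIso_of_isFSM σ hσ
  refine hX ((LinearMap.finrank_le_finrank_of_injective (f := (inv σ).toAlgHom.toLinearMap)
    ((inv σ).toAlgHom : X.L →+* (⊥ : IntermediateField K Kt)).injective).trans ?_)
  rw [IntermediateField.finrank_bot]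

/-- `K`-algebra maps out of the bottom field `K ⊆ Kt` agree (they are determined on `K`).
[cite: MochizukiFrdI2008, Ex. 6.1 p.109] -/
theorem FinSubextCat.algHom_bot_eq {A : Type*} [Semiring A] [Algebra K A]
    (φ ψ : (⊥ : IntermediateField K Kt) →ₐ[K] A) : φ = ψ := by
  apply AlgHom.ext
  intro z
  obtain ⟨q, hq⟩ := IntermediateField.mem_bot.mp z.2
  have hz : z = algebraMap K (⊥ : IntermediateField K Kt) q := Subtype.ext (by simpa using hq.symm)
  rw [hz, AlgHom.commutes, AlgHom.commutes]

/-- **A rigid generator gives an FSM-morphism `Spec K(α) → Spec K`.** If `α ∈ Kt` is integral over `K` and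
RIGID — every `K`-algebra map `K(α) → Kt` fixes `α` — then `Spec K(α) → Spec K` is a monomorphism of `D`
(parallel arrows into `Spec K(α)` agree on `α`) and fiberwise-surjective (composita), i.e. an FSM-morphism.
[cite: MochizukiFrdI2008, Thm. 6.2 (iii) p.111] -/
theorem FinSubextCat.isFSM_of_rigid (α : Kt) (hαint : _root_.IsIntegral K α) [FiniteDimensional K K⟮α⟯]
    (hrig : ∀ ψ : K⟮α⟯ →ₐ[K] Kt, ψ (AdjoinSimple.gen K α) = α) :
    IsFSM (C := FinSubextCat K Kt) (B := FinSubextCat.mk K⟮α⟯) (A := FinSubextCat.mk ⊥)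
      (FinSubextCat.Hom.mk (IntermediateField.inclusion bot_le)) := by
  let Xα : FinSubextCat K Kt := ⟨K⟮α⟯⟩
  let X₀ : FinSubextCat K Kt := ⟨⊥⟩
  let σ : Xα ⟶ X₀ := ⟨IntermediateField.inclusion bot_le⟩
  -- σ is a monomorphism (rigidity) …
  have hmono : Mono σ := by
    refine ⟨fun {W} g₁ g₂ _ => FinSubextCat.hom_ext ?_⟩
    have key : (W.L.val).comp g₁.toAlgHom = (W.L.val).comp g₂.toAlgHom :=
      (adjoin.powerBasis hαint).algHom_ext (by
        rw [adjoin.powerBasis_gen]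
        exact (hrig _).trans (hrig _).symm)
    exact AlgHom.ext fun z => Subtype.ext (by simpa using DFunLike.congr_fun key z)
  -- … and fiberwise-surjective (composita)
  have hfs : IsFiberwiseSurjective σ := by
    intro W γ
    exact ⟨⟨W.L ⊔ K⟮α⟯⟩, ⟨IntermediateField.inclusion le_sup_right⟩, ⟨IntermediateField.inclusion le_sup_left⟩,
      FinSubextCat.hom_ext (FinSubextCat.algHom_bot_eq _ _)⟩
  exact ⟨hfs, hmono⟩

/-- **Rigidity kills FSM-type.** If `α ∈ Kt` is integral over `K`, not in `K`, and rigid, then the FSM-morphism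
`Spec K(α) → Spec K` is not an isomorphism, so `D = FinSubextCat K Kt` is not of FSM-type (contrast p. 111,
`K̃/K` Galois: every monomorphism of `D` is an isomorphism). [cite: MochizukiFrdI2008, Thm. 6.2 (iii) p.111] -/
theorem FinSubextCat.not_isOfFSMType_of_rigid (α : Kt) (hαint : _root_.IsIntegral K α)
    (hα : α ∉ (⊥ : IntermediateField K Kt)) (hrig : ∀ ψ : K⟮α⟯ →ₐ[K] Kt, ψ (AdjoinSimple.gen K α) = α) :
    ¬ IsOfFSMType (FinSubextCat K Kt) := by
  haveI : FiniteDimensional K K⟮α⟯ := adjoin.finiteDimensional hαint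
  have hfin : ¬ Module.finrank K K⟮α⟯ ≤ 1 := by
    intro hle
    have h1 : Module.finrank K K⟮α⟯ = 1 := le_antisymm hle Module.finrank_pos
    exact hα (adjoin_simple_eq_bot_iff.mp (finrank_eq_one_iff.mp h1))
  exact FinSubextCat.not_isOfFSMType_of_isFSM_to_bot ⟨K⟮α⟯⟩ hfin _
    (FinSubextCat.isFSM_of_rigid α hαint hrig)

end Rigid

/-! ### Two base categories that are not of FSM-type -/

/-- **`D` for `ℝ/ℚ` is not of FSM-type**: the real cube root of `2` is rigid (a `ℚ`-algebra map out of `ℚ(∛2)`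
into a subfield of `ℝ` sends `∛2` to the unique real cube root of `2`) and irrational.
[cite: MochizukiFrdI2008, Thm. 6.2 (iii) p.111] -/
theorem FinSubextCat.not_isOfFSMType_rat_real : ¬ IsOfFSMType (FinSubextCat ℚ ℝ) := by
  -- the real cube root of 2: a real number, integral over ℚ, irrational
  obtain ⟨α, hα3⟩ : ∃ α : ℝ, α ^ 3 = 2 :=
    ⟨(2 : ℝ) ^ ((3 : ℕ) : ℝ)⁻¹, Real.rpow_inv_natCast_pow (by norm_num) (by norm_num)⟩
  have hαint : _root_.IsIntegral ℚ α :=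
    ⟨X ^ 3 - C 2, monic_X_pow_sub_C _ (by norm_num), by simp [hα3]⟩
  have hirr : Irrational α := by
    refine irrational_nrt_of_notint_nrt 3 2 (by exact_mod_cast hα3) ?_ (by norm_num)
    rintro ⟨y, hy⟩
    have h3 : y ^ 3 = 2 := by exact_mod_cast (show (y : ℝ) ^ 3 = 2 by rw [← hy]; exact hα3)
    have hdvd : y ∣ 2 := ⟨y ^ 2, by rw [← h3]; ring⟩
    have hle : y ≤ 2 := Int.le_of_dvd (by norm_num) hdvd
    have hge : -2 ≤ y := by
      have := Int.le_of_dvd (by norm_num) (Int.neg_dvd.mpr hdvd)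
      omega
    interval_cases y <;> omega
  have hα_not_mem : α ∉ (⊥ : IntermediateField ℚ ℝ) := by
    rw [IntermediateField.mem_bot]
    rintro ⟨q, hq⟩
    exact hirr ⟨q, ((eq_ratCast (algebraMap ℚ ℝ) q).symm.trans hq)⟩
  refine FinSubextCat.not_isOfFSMType_of_rigid α hαint hα_not_mem fun ψ => ?_
  -- rigidity: a ℚ-algebra map out of ℚ(α) into ℝ sends α to the unique real cube root of 2
  have hgen3 : AdjoinSimple.gen ℚ α ^ 3 = 2 := by
    apply Subtype.ext
    rw [SubmonoidClass.coe_pow, AdjoinSimple.coe_gen, hα3]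
    norm_cast
  have h3 : (ψ (AdjoinSimple.gen ℚ α)) ^ 3 = 2 := by
    rw [← map_pow, hgen3, map_ofNat]
  exact (Odd.strictMono_pow (⟨1, rfl⟩ : Odd 3)).injective (h3.trans hα3.symm)

open Literature.Barriers.ResolutionOfSingularities in
/-- **`D` for the purely inseparable `𝔽_p(t^{1/p})/𝔽_p(t)` is not of FSM-type** (characteristic `p`): the
generator `s = t^{1/p}` is rigid (a `p`-th root is unique in a field of characteristic `p`) and `s ∉ 𝔽_p(t)`.
[cite: MochizukiFrdI2008, Thm. 6.2 (iii) p.111] -/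
theorem FinSubextCat.not_isOfFSMType_inseparable (p : ℕ) [hp : Fact p.Prime] :
    ¬ IsOfFSMType (FinSubextCat (baseField p) (extField p)) := by
  set α : extField p := AdjoinRoot.root (insepPoly p) with hαdef
  have hαp : α ^ p = algebraMap (baseField p) (extField p) RatFunc.X := root_pow_eq p
  have hαint : _root_.IsIntegral (baseField p) α := by
    refine ⟨X ^ p - C RatFunc.X, monic_X_pow_sub_C _ hp.out.ne_zero, ?_⟩
    rw [eval₂_sub, eval₂_X_pow, eval₂_C, hαp, sub_self]
  have hα : α ∉ (⊥ : IntermediateField (baseField p) (extField p)) := fun h =>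
    root_not_mem_range p (IntermediateField.mem_bot.mp h)
  refine FinSubextCat.not_isOfFSMType_of_rigid α hαint hα fun ψ => ?_
  -- rigidity: `p`-th roots of `t` are unique in `extField p`
  have hgenp : AdjoinSimple.gen (baseField p) α ^ p =
      algebraMap (baseField p) (baseField p)⟮α⟯ RatFunc.X := by
    apply Subtype.ext
    rw [SubmonoidClass.coe_pow, AdjoinSimple.coe_gen, hαp]
    rfl
  have hy : ψ (AdjoinSimple.gen (baseField p) α) ^ p = α ^ p := by
    rw [← map_pow, hgenp, AlgHom.commutes, hαp]
  have h0 : (ψ (AdjoinSimple.gen (baseField p) α) - α) ^ p = 0 := by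
    rw [sub_pow_char, hy, sub_self]
  exact sub_eq_zero.mp ((pow_eq_zero_iff hp.out.ne_zero).mp h0)

/-! ### T62ii/L04: `C_{K̃/K}` is a Frobenioid for every `Γ` iff `D` is of FSM-type -/

section Thm62

variable {K : Type} [Field K] {Kt : Type} [Field Kt] [Algebra K Kt]

/-- **If `D` is not of FSM-type, some admissible interface datum has `Φ` NOT a monoid on `D`** (Def. 1.1 (ii)(b)
fails): for an FSM-morphism `σ : Spec L → Spec M` that is not an isomorphism, the datum `Γ_σ` (`D_N = {pt}`,
`Φ(N) = {D | [N : K] ≤ [M : K] → D(pt) even}`, `B(N) = 1`, identity `over`, ramification `1`; saturated,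
`ℚ`-Cartier, functorial since degrees grow along arrows) has `1 ∈ Φ(L)` with no `σ^*`-preimage in `Φ(M)` — the
same datum as abc-iut-f-043's `exists_not_Thm62_geomHypotheses_of_not_isOfFSMType`, sharpened to the one clause
a pre-Frobenioid needs. [cite: MochizukiFrdI2008, Ex. 6.1 p.109] -/
theorem exists_not_isMonoidOn_geomDivisorFunctor_of_not_isOfFSMType (hD : ¬ IsOfFSMType (FinSubextCat K Kt)) :
    ∃ Γ : GeometricDivisorData K Kt, ¬ IsMonoidOn (geomDivisorFunctor Γ) := by
  -- an FSM-morphism σ : X ⟶ Y (field map Y.L → X.L) that is not an isomorphism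
  obtain ⟨X, Y, σ, hσ, hnot⟩ : ∃ (X Y : FinSubextCat K Kt) (σ : X ⟶ Y), IsFSM σ ∧ ¬ IsIso σ := by
    by_contra hc
    refine hD ⟨fun {A B} f hf => ?_⟩
    by_contra hf'
    exact hc ⟨A, B, f, hf, hf'⟩
  -- its field map is not surjective, so the degree of X exceeds that of Y
  have hns : ¬ Module.finrank K X.L ≤ Module.finrank K Y.L := by
    intro hle
    have heq : Module.finrank K Y.L = Module.finrank K X.L :=
      le_antisymm (LinearMap.finrank_le_finrank_of_injective (f := σ.toAlgHom.toLinearMap)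
        (σ.toAlgHom : Y.L →+* X.L).injective) hle
    have hsurj : Surjective σ.toAlgHom.toLinearMap :=
      (LinearMap.injective_iff_surjective_of_finrank_eq_finrank heq).mp (σ.toAlgHom : Y.L →+* X.L).injective
    have hbij : Bijective σ.toAlgHom := ⟨(σ.toAlgHom : Y.L →+* X.L).injective, fun y => hsurj y⟩
    exact hnot (FinSubextCat.isIso_of_bijective σ hbij)
  -- the datum Γ_σ
  let Γ : GeometricDivisorData K Kt :=
    { primeDiv := fun _ => Unit
      Phi := fun N =>
        { carrier := {D | Module.finrank K N.L ≤ Module.finrank K Y.L → Even (D ())}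
          zero_mem' := fun _ => ⟨0, rfl⟩
          add_mem' := fun {D E} hDm hEm hN => by
            rw [Finsupp.add_apply]
            exact (hDm hN).add (hEm hN) }
      B := fun _ => ⊥
      div := fun _ => 1
      over := fun _ Q => Q
      ram := fun _ _ => 1
      ram_pos := fun _ _ => Nat.one_pos
      over_finite := fun _ _ => Set.toFinite _
      over_surjective := fun _ => Function.surjective_id
      over_id := fun _ _ => rfl
      ram_id := fun _ _ => rfl
      over_comp := fun _ _ _ => rfl
      ram_comp := fun _ _ _ => rfl
      pull_mem := fun {N M} τ D hDm hM => by
        rw [DivisorCoeff.pull_apply, Nat.cast_one, one_mul]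
        exact hDm ((LinearMap.finrank_le_finrank_of_injective (f := τ.toAlgHom.toLinearMap)
          (τ.toAlgHom : N.L →+* M.L).injective).trans hM)
      map_mem := fun τ f hf => by
        rw [Subgroup.mem_bot] at hf ⊢
        rw [hf, map_one]
      div_natural := fun τ f => by simp
      div_mem_gp := fun N f => ⟨0, zero_mem _, 0, zero_mem _, by simp⟩
      qCartier := fun N P => ⟨2, two_pos, fun _ => by rw [Finsupp.single_eq_same]; exact ⟨1, rfl⟩⟩
      sub_mem := fun N D E hDm hEm hle hN => by
        rw [Finsupp.tsub_apply]
        exact (Nat.even_sub (hle ())).mpr (iff_of_true (hDm hN) (hEm hN))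
      primeDiv_nonempty := ⟨Y, ⟨()⟩⟩ }
  refine ⟨Γ, fun h => ?_⟩
  have hbij := h.bijective_of_isFSM σ hσ
  have hmem : (Finsupp.single () 1 : Unit →₀ ℕ) ∈ Γ.Phi X := fun hle => (hns hle).elim
  obtain ⟨x, hx⟩ := hbij.2 (Multiplicative.ofAdd ⟨Finsupp.single () 1, hmem⟩)
  have hx1 : ((Multiplicative.toAdd x : Γ.Phi Y) : Unit →₀ ℕ) () = 1 := by
    have h' := congrArg (fun z => ((Multiplicative.toAdd z : Γ.Phi X) : Unit →₀ ℕ) ()) hx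
    change ((1 : ℕ) : ℕ) * ((Multiplicative.toAdd x : Γ.Phi Y) : Unit →₀ ℕ) () =
      (Finsupp.single () 1 : Unit →₀ ℕ) () at h'
    rwa [one_mul, Finsupp.single_eq_same] at h'
  have heven : Even (((Multiplicative.toAdd x : Γ.Phi Y) : Unit →₀ ℕ) ()) :=
    (Multiplicative.toAdd x).2 le_rfl
  rw [hx1] at heven
  exact Nat.not_even_one heven

/-- **T62ii/L04 for EVERY `Γ` when `D` is of FSM-type** (the property the printed proof invokes, p. 111): Thm. 5.2
(ii) applied to abc-iut-f-043's `geom_hypotheses_of_isOfFSMType`; the Galois case is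
`Thm62_geomIsFrobenioid_holds`. [cite: MochizukiFrdI2008, Thm. 6.2 p.110] -/
theorem Thm62_geomIsFrobenioid_of_isOfFSMType (hD : IsOfFSMType (FinSubextCat K Kt))
    (Γ : GeometricDivisorData K Kt) : Thm62_geomIsFrobenioid Γ :=
  Thm62_geomIsFrobenioid_of_hypotheses Γ (geom_hypotheses_of_isOfFSMType hD Γ)

/-- **If `D` is not of FSM-type, T62ii/L04 fails for some `Γ`**: a Frobenioid is a pre-Frobenioid, whose divisor
monoid is a monoid on `D` (Def. 1.1 (iv)); `Γ_σ`'s is not. [cite: MochizukiFrdI2008, Thm. 6.2 p.110] -/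
theorem exists_not_Thm62_geomIsFrobenioid_of_not_isOfFSMType (hD : ¬ IsOfFSMType (FinSubextCat K Kt)) :
    ∃ Γ : GeometricDivisorData K Kt, ¬ Thm62_geomIsFrobenioid Γ := by
  obtain ⟨Γ, hΓ⟩ := exists_not_isMonoidOn_geomDivisorFunctor_of_not_isOfFSMType hD
  exact ⟨Γ, fun h => hΓ h.isPreFrobenioid.isMonoidOn⟩

/-- **T62ii/L04 `Thm62_geomIsFrobenioid`: exact dependence on the base category** — `C_{K̃/K}` is a Frobenioid for
EVERY interface datum `Γ` iff `D = FinSubextCat K Kt` is of FSM-type. [cite: MochizukiFrdI2008, Thm. 6.2 p.110] -/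
theorem forall_Thm62_geomIsFrobenioid_iff_isOfFSMType :
    (∀ Γ : GeometricDivisorData K Kt, Thm62_geomIsFrobenioid Γ) ↔ IsOfFSMType (FinSubextCat K Kt) := by
  refine ⟨fun h => ?_, fun hD Γ => Thm62_geomIsFrobenioid_of_isOfFSMType hD Γ⟩
  by_contra hD
  obtain ⟨Γ, hΓ⟩ := exists_not_Thm62_geomIsFrobenioid_of_not_isOfFSMType hD
  exact hΓ (h Γ)

/-! ### T62ii/L06: Thm. 6.2 (ii) with its Frobenioid premise, for every `Γ` iff `D` is of FSM-type -/

/-- **T62ii/L06 for EVERY `Γ` when `D` is of FSM-type**: T62ii/L04 (`Thm62_geomIsFrobenioid_of_isOfFSMType`)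
composed with abc-iut-L6-t10's `Thm62ii_holds` through the trunk's `Thm62ii_unconditional_of`; the Galois case is
`Thm62ii_unconditional_holds`. [cite: MochizukiFrdI2008, Thm. 6.2 (ii) p.111] -/
theorem Thm62ii_unconditional_of_isOfFSMType (hD : IsOfFSMType (FinSubextCat K Kt))
    (Γ : GeometricDivisorData K Kt) (p : ℕ) [Fact p.Prime] [CharP K p] : Thm62ii_unconditional Γ p :=
  Thm62ii_unconditional_of Γ p (Thm62_geomIsFrobenioid_of_isOfFSMType hD Γ) (Thm62ii_holds Γ p)

/-- **If `D` is not of FSM-type, T62ii/L06 fails for some `Γ`** (its first component is T62ii/L04).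
[cite: MochizukiFrdI2008, Thm. 6.2 (ii) p.111] -/
theorem exists_not_Thm62ii_unconditional_of_not_isOfFSMType (hD : ¬ IsOfFSMType (FinSubextCat K Kt))
    (p : ℕ) [Fact p.Prime] [CharP K p] : ∃ Γ : GeometricDivisorData K Kt, ¬ Thm62ii_unconditional Γ p := by
  obtain ⟨Γ, hΓ⟩ := exists_not_isMonoidOn_geomDivisorFunctor_of_not_isOfFSMType hD
  exact ⟨Γ, fun ⟨hF, _⟩ => hΓ hF.isPreFrobenioid.isMonoidOn⟩

/-- **T62ii/L06 `Thm62ii_unconditional`: exact dependence on the base category** (characteristic `p`) — it holds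
for EVERY interface datum `Γ` iff `D = FinSubextCat K Kt` is of FSM-type. [cite: MochizukiFrdI2008, Thm. 6.2 (ii) p.111] -/
theorem forall_Thm62ii_unconditional_iff_isOfFSMType (p : ℕ) [Fact p.Prime] [CharP K p] :
    (∀ Γ : GeometricDivisorData K Kt, Thm62ii_unconditional Γ p) ↔ IsOfFSMType (FinSubextCat K Kt) := by
  refine ⟨fun h => ?_, fun hD Γ => Thm62ii_unconditional_of_isOfFSMType hD Γ p⟩
  by_contra hD
  obtain ⟨Γ, hΓ⟩ := exists_not_Thm62ii_unconditional_of_not_isOfFSMType hD p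
  exact hΓ (h Γ)

end Thm62

/-! ### The universal closures AS TYPED are false -/

/-- **F-1134, universal closure AS TYPED (no Galois hypothesis) is false**: over `K = ℚ ⊆ K̃ = ℝ` the base
category is not of FSM-type, so some interface datum's model is not even a pre-Frobenioid. The printed
instance form (`K̃/K` Galois) is `Thm62_geomIsFrobenioid_holds`. [cite: MochizukiFrdI2008, Thm. 6.2 p.110] -/
theorem not_forall_Thm62_geomIsFrobenioid :
    ¬ ∀ {K : Type} [Field K] {Kt : Type} [Field Kt] [Algebra K Kt] (Γ : GeometricDivisorData K Kt),
        Thm62_geomIsFrobenioid Γ := by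
  intro h
  obtain ⟨Γ, hΓ⟩ :=
    exists_not_Thm62_geomIsFrobenioid_of_not_isOfFSMType FinSubextCat.not_isOfFSMType_rat_real
  exact hΓ (h Γ)

open Literature.Barriers.ResolutionOfSingularities in
/-- **F-1135, universal closure AS TYPED (no Galois hypothesis) is false**: in characteristic `2`, over
`K = 𝔽_2(t) ⊆ K̃ = 𝔽_2(t^{1/2})` the base category is not of FSM-type, so for some interface datum the model is
not a Frobenioid and the `∃ hF, …` of T62ii/L06 is empty. The printed instance form (`K̃/K` Galois) is
`Thm62ii_unconditional_holds`. [cite: MochizukiFrdI2008, Thm. 6.2 (ii) p.111] -/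
theorem not_forall_Thm62ii_unconditional :
    ¬ ∀ {K : Type} [Field K] {Kt : Type} [Field Kt] [Algebra K Kt] (Γ : GeometricDivisorData K Kt)
        (p : ℕ) [Fact p.Prime] [CharP K p], Thm62ii_unconditional Γ p := by
  intro h
  haveI : CharP (baseField 2) 2 :=
    charP_of_injective_algebraMap (algebraMap (ZMod 2) (baseField 2)).injective 2
  obtain ⟨Γ, hΓ⟩ :=
    exists_not_Thm62ii_unconditional_of_not_isOfFSMType (FinSubextCat.not_isOfFSMType_inseparable 2) 2
  exact hΓ (h Γ 2)

end Literature.AlgebraicGeometry.Frobenioids
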